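import Literature.Barriers.RiemannHypothesis.LiouvilleSignConjectures
import Literature.NumberTheory.LFunctions.AndersonStarkLiouville
import Literature.NumberTheory.LFunctions.AndersonStarkLiouvilleHolds
import Literature.NumberTheory.LFunctions.AndersonStarkLiouvilleProofs
import HarnessLib

/-!
# `L(n) > 0.061867√n` infinitely often (BFM 2008, Thm. 2): the printed deduction, at the barrier

Sibling of `Literature/Barriers/RiemannHypothesis/LiouvilleSignConjectures.lean`, which vendors
Borwein–Ferguson–Mossinghoff's Theorem 2 ("There exist infinitely many positive integers `n` for
which `L(n) > .061867√n`", Math. Comp. 77 (2008), p. 1685) as the named fact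
`Literature.Barriers.RiemannHypothesis.BFM2008_thm2`. Its printed proof (p. 1692, §3.2) is one
sentence: "A local maximum is achieved at `n₅ = 351 753 358 289 465`, where `L(n₅) = 1 160 327`.
Theorem 2 follows immediately from this value by using the results of Anderson and Stark [1],
since `L(n₅)/√n₅ = 0.0618673…`." The tree's
`Literature/NumberTheory/LFunctions/AndersonStarkLiouville.lean` vendors the two ingredients as
named facts — Anderson–Stark's "proof by example" inequality
`limsup L(x)/√x ≥ (L(x₀) − I(x₀))/√x₀` (`AndersonStark1981_liouville`, LNM 899 (1981), §4
Thm. 1) with their bound (18) on Fawaz's `I(x)` (`AndersonStark1981_fawazI_bound`), and the datum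
`L(n₅) = 1 160 327` (`BFM2008_liouvilleSum_n5`) — and PROVES the deduction
(`Literature.NumberTheory.LFunctions.BFM2008_thm2_of_facts`, at the continuity point
`x₀ = n₅ + ½`: `I(x₀) ≤ 2`, `0.061867·√x₀ < 1 160 325`). This file records it against the barrier's
declaration:

* `BFM2008_thm2_of_andersonStark : AndersonStark1981_liouville → AndersonStark1981_fawazI_bound →
  BFM2008_liouvilleSum_n5 → BFM2008_thm2`.

So `BFM2008_thm2` is CONDITIONAL on exactly these three named facts. Two of them are now THEOREMS
of the tree — Anderson–Stark's inequality (`AndersonStark1981_liouville_holds`,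
`AndersonStarkLiouvilleHolds.lean`: Ingham's kernel theorem, Landau's theorem, the Gaussian
smoothing and the contour step) and the bound (18) (`AndersonStark1981_fawazI_bound_holds`,
`AndersonStarkLiouvilleProofs.lean`) — so (appended) `BFM2008_thm2_of_liouvilleSum_n5` reduces the
barrier fact to the single computed datum `L(351 753 358 289 465) = 1 160 327`
(`BFM2008_liouvilleSum_n5`, BFM §3.2: a machine computation with Lehman's `O(x^{2/3})` formula and a
table of `λ(n)`, `n ≤ 4·10^{10}`), which has no certified counterpart in the tree yet;
`BFM2008_thm2_holds` will be the one-liner `BFM2008_thm2_of_liouvilleSum_n5 BFM2008_liouvilleSum_n5_holds`.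

## References

* [BorweinFergusonMossinghoff2008] P. Borwein, R. Ferguson, M. J. Mossinghoff, *Sign changes in
  sums of the Liouville function*, Math. Comp. 77 (2008), 1681–1694 — Thm. 2 (p. 1685) and §3.2
  (p. 1692) (read).
* [AndersonStark1981] R. J. Anderson, H. M. Stark, *Oscillation theorems*, LNM 899 (1981), 79–106 —
  §4 Thm. 1, (16)–(18) (read; through `AndersonStarkLiouville.lean`).
-/

noncomputable section

namespace Literature.Barriers.RiemannHypothesis

open Literature.NumberTheory.LFunctions in
/-- **BFM 2008, Theorem 2, as deduced in print** from Anderson–Stark's inequality, their bound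
(18) on `I(x)`, and the computed value `L(351 753 358 289 465) = 1 160 327`: infinitely many
positive integers `n` have `L(n) > 0.061867√n` — the barrier's `BFM2008_thm2`, conditional on the
three named facts of `AndersonStarkLiouville.lean` (the work is
`Literature.NumberTheory.LFunctions.BFM2008_thm2_of_facts`, whose conclusion is this statement
verbatim). [cite: BorweinFergusonMossinghoff2008, Theorem 2 and §3.2 (p. 1692)]
[cite: AndersonStark1981, §4 Theorem 1 and (18)] -/
theorem BFM2008_thm2_of_andersonStark (hAS : AndersonStark1981_liouville)
    (hI : AndersonStark1981_fawazI_bound) (hL : BFM2008_liouvilleSum_n5) : BFM2008_thm2 :=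
  BFM2008_thm2_of_facts hAS hI hL

open Literature.NumberTheory.LFunctions in
/-- **BFM 2008, Theorem 2, reduced to its computed datum.** With Anderson–Stark's inequality and
their bound (18) discharged in the tree (`AndersonStark1981_liouville_holds`,
`AndersonStark1981_fawazI_bound_holds`), the barrier fact `BFM2008_thm2` ("`L(n) > 0.061867√n` for
infinitely many `n`") follows from the single value `L(351 753 358 289 465) = 1 160 327` of BFM §3.2
(`BFM2008_liouvilleSum_n5`) — exactly the printed deduction "Theorem 2 follows immediately from this
value by using the results of Anderson and Stark". [cite: BorweinFergusonMossinghoff2008, Theorem 2 and §3.2 (p. 1692)]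
[cite: AndersonStark1981, §4 Theorem 1 and (18)] -/
theorem BFM2008_thm2_of_liouvilleSum_n5 (hL : BFM2008_liouvilleSum_n5) : BFM2008_thm2 :=
  BFM2008_thm2_of_andersonStark AndersonStark1981_liouville_holds AndersonStark1981_fawazI_bound_holds hL

end Literature.Barriers.RiemannHypothesis
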